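import Mathlib
import Literature.Barriers.ValiantsHypothesis.AlgebraicNaturalProofs

/-!
# Route BarrierLever — item `PartitionMinorsHitByVP` (stmt-ValiantsHypothesis-19717):
# the TWO-WIDE-SLOTS OBSTRUCTION for the simplex-product join door (kernel form of the seat's (O2), j = 2)

Helper file (`--supports stmt-ValiantsHypothesis-19717`; cell valiant-natproofs, rung V4, 𝒟-side door (c), line
`hidden_states`; prover seat val-np-p3 gen 11). Definition-free. Closes NO item. A NO-GO lemma for designs.

In the exact-support door (`…SimplexJoinDoor`) a piece `p` whose factor slots `f₁ ≠ f₂` both offer at least `h + 1` options has,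
inside its column set, the sub-grid `({none} ∪ S p f₁) × ({none} ∪ S p f₂)` (other slots at `none`): two families of `≥ h + 2`
points of `ℂ^h`, each AFFINELY DEPENDENT (`affineRelation_of_card`). The tensor product `λ ⊗ μ` of two affine dependencies is a
column relation on every row of size `≤ 3` (`sum_sum_prod_eq_zero`: in the expansion of `∏_{a ∈ U} (c_a + x_a + y_a)` every term has
`≤ 1` factor from `x` or `≤ 1` factor from `y`). Hence (**`det_eq_zero_of_two_wide_slots`**) for EVERY row family `u` all of whose
members have size `≤ 3` and EVERY table, the `u`-side matrix of the design is SINGULAR — whatever the other pieces are. This is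
the `j = 2` case of the seat's affine-dependence-tensor obstruction (memo §3 (O2), §9 tensor-level law): e.g. the piece `V_{h+2} × V_{h+2}`
is not uniform for `h ≥ 9` (`C(h,≤3) ≥ (h+2)²`), and the base-`(h+1)` digit join fails on the thin families of the h = 9 census.
Nothing on crux 14610 or VP ≠ VNP.
-/

set_option linter.dupNamespace false

namespace Summit.ValiantsHypothesis.ValiantsHypothesis.Theorems.BarrierLever.SimplexJoin

open Finset Matrix

/-- **Affine dependence.** More than `h + 1` points of `ℂ^h` indexed by a finset `L` carry weights, not all zero, with total
weight `0` and weighted sum `0` (coordinatewise). -/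
theorem affineRelation_of_card (h : ℕ) {α : Type*} [DecidableEq α] (L : Finset α) (x : α → Fin h → ℂ)
    (hcard : h + 1 < L.card) :
    ∃ Λ : α → ℂ, (∑ o ∈ L, Λ o = 0) ∧ (∀ a, ∑ o ∈ L, Λ o * x o a = 0) ∧ ∃ o ∈ L, Λ o ≠ 0 := by
  classical
  have hli : ¬ LinearIndependent ℂ (fun o : L => ((x o, (1 : ℂ)) : (Fin h → ℂ) × ℂ)) := by
    intro hli
    have hle := hli.fintype_card_le_finrank
    rw [Module.finrank_prod, Module.finrank_fin_fun, Module.finrank_self, Fintype.card_coe] at hle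
    omega
  obtain ⟨g, hg, o₀, ho₀⟩ := Fintype.not_linearIndependent_iff.mp hli
  refine ⟨fun o => if ho : o ∈ L then g ⟨o, ho⟩ else 0, ?_, ?_, ⟨o₀, o₀.2, by simpa using ho₀⟩⟩
  · have h2 := congrArg Prod.snd hg
    simp only [Prod.snd_sum, Prod.smul_snd, smul_eq_mul, mul_one, Prod.snd_zero] at h2
    rw [← Finset.sum_coe_sort L]
    simpa using h2
  · intro a
    have h1 := congrArg (fun v : (Fin h → ℂ) × ℂ => v.1 a) hg
    simp only [Prod.fst_sum, Finset.sum_apply, Prod.smul_fst, Pi.smul_apply, smul_eq_mul, Prod.fst_zero,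
      Pi.zero_apply] at h1
    rw [← Finset.sum_coe_sort L]
    simpa using h1

/-- One factor: an affine dependency kills every product of at most one affine-linear factor. -/
theorem sum_mul_prod_eq_zero_of_card_le_one {h : ℕ} {α : Type*} (L : Finset α) (Λ : α → ℂ) (x : α → Fin h → ℂ)
    (h0 : ∑ o ∈ L, Λ o = 0) (h1 : ∀ a, ∑ o ∈ L, Λ o * x o a = 0) (c : Fin h → ℂ) (V : Finset (Fin h))
    (hV : V.card ≤ 1) : ∑ o ∈ L, Λ o * ∏ a ∈ V, (c a + x o a) = 0 := by
  rcases Nat.le_one_iff_eq_zero_or_eq_one.mp hV with hV0 | hV1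
  · rw [Finset.card_eq_zero.mp hV0]
    simpa using h0
  · obtain ⟨a, rfl⟩ := Finset.card_eq_one.mp hV1
    simp only [Finset.prod_singleton, mul_add, Finset.sum_add_distrib]
    rw [h1 a, add_zero, ← Finset.sum_mul, h0, zero_mul]

/-- **The tensor of two affine dependencies kills every row of size ≤ 3.** -/
theorem sum_sum_prod_eq_zero {h : ℕ} {α β : Type*} (L₁ : Finset α) (L₂ : Finset β) (Λ : α → ℂ) (Μ : β → ℂ)
    (x : α → Fin h → ℂ) (y : β → Fin h → ℂ) (c : Fin h → ℂ)
    (hl0 : ∑ o ∈ L₁, Λ o = 0) (hl1 : ∀ a, ∑ o ∈ L₁, Λ o * x o a = 0)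
    (hm0 : ∑ o ∈ L₂, Μ o = 0) (hm1 : ∀ a, ∑ o ∈ L₂, Μ o * y o a = 0)
    (U : Finset (Fin h)) (hU : U.card ≤ 3) :
    ∑ o ∈ L₁, ∑ o' ∈ L₂, Λ o * Μ o' * ∏ a ∈ U, (c a + x o a + y o' a) = 0 := by
  -- expand in `y`: `∏ (y + (c + x)) = Σ_W (∏_W y) (∏_{U \ W} (c + x))`
  have hexp : ∀ o o', ∏ a ∈ U, (c a + x o a + y o' a) =
      ∑ W ∈ U.powerset, (∏ a ∈ W, y o' a) * ∏ a ∈ U \ W, (c a + x o a) := by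
    intro o o'
    rw [← Finset.prod_add]
    exact Finset.prod_congr rfl fun a _ => by ring
  have hinner : ∀ o, ∑ o' ∈ L₂, Μ o' * ∏ a ∈ U, (c a + x o a + y o' a) =
      ∑ W ∈ U.powerset, (∑ o' ∈ L₂, Μ o' * ∏ a ∈ W, y o' a) * ∏ a ∈ U \ W, (c a + x o a) := by
    intro o
    simp_rw [hexp, Finset.mul_sum]
    rw [Finset.sum_comm]
    refine Finset.sum_congr rfl fun W _ => ?_
    rw [Finset.sum_mul]
    exact Finset.sum_congr rfl fun o' _ => by ring
  calc ∑ o ∈ L₁, ∑ o' ∈ L₂, Λ o * Μ o' * ∏ a ∈ U, (c a + x o a + y o' a)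
      = ∑ o ∈ L₁, Λ o * ∑ o' ∈ L₂, Μ o' * ∏ a ∈ U, (c a + x o a + y o' a) := by
        refine Finset.sum_congr rfl fun o _ => ?_
        rw [Finset.mul_sum]
        exact Finset.sum_congr rfl fun o' _ => by ring
    _ = ∑ o ∈ L₁, Λ o * ∑ W ∈ U.powerset,
          (∑ o' ∈ L₂, Μ o' * ∏ a ∈ W, y o' a) * ∏ a ∈ U \ W, (c a + x o a) := by simp_rw [hinner]
    _ = ∑ W ∈ U.powerset, (∑ o' ∈ L₂, Μ o' * ∏ a ∈ W, y o' a) *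
          ∑ o ∈ L₁, Λ o * ∏ a ∈ U \ W, (c a + x o a) := by
        simp_rw [Finset.mul_sum]
        rw [Finset.sum_comm]
        refine Finset.sum_congr rfl fun W _ => Finset.sum_congr rfl fun o _ => by ring
    _ = 0 := by
        refine Finset.sum_eq_zero fun W hW => ?_
        have hWU : W ⊆ U := Finset.mem_powerset.mp hW
        by_cases hWc : W.card ≤ 1
        · have hy0 : ∑ o' ∈ L₂, Μ o' * ∏ a ∈ W, y o' a = 0 := by
            have := sum_mul_prod_eq_zero_of_card_le_one L₂ Μ y hm0 hm1 0 W hWc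
            simpa using this
          rw [hy0, zero_mul]
        · have hrest : (U \ W).card ≤ 1 := by
            have := Finset.card_sdiff_add_card_eq_card hWU
            omega
          rw [sum_mul_prod_eq_zero_of_card_le_one L₁ Λ x hl0 hl1 c (U \ W) hrest, mul_zero]

/-- **THE TWO-WIDE-SLOTS OBSTRUCTION.** In the exact-support door, let the design `e` (injective, exactly the live columns
of `S`) have a piece `p` and factor slots `f₁ ≠ f₂` with `|S p f₁|, |S p f₂| ≥ h + 1`. Then for EVERY row family
`u : Fin r → Finset (Fin h)` all of whose members have size `≤ 3` and EVERY table `T`, the `u`-side matrix of the design is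
singular. -/
theorem det_eq_zero_of_two_wide_slots (h m D N r : ℕ) (u : Fin r → Finset (Fin h)) (hu3 : ∀ i, (u i).card ≤ 3)
    (S : Fin m → Fin D → Finset (Fin N))
    (e : Fin r → Fin m × (Fin D → Option (Fin N))) (he : Function.Injective e)
    (hlive : ∀ c : Fin m × (Fin D → Option (Fin N)),
      c ∈ Set.range e ↔ ∀ (f : Fin D) (j : Fin N), c.2 f = some j → j ∈ S c.1 f)
    (p : Fin m) (f₁ f₂ : Fin D) (hf : f₁ ≠ f₂) (hS₁ : h + 1 ≤ (S p f₁).card) (hS₂ : h + 1 ≤ (S p f₂).card)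
    (T : Fin m → Option (Fin D × Fin N) → Fin h → ℂ) :
    (Matrix.of fun i k : Fin r => ∏ a ∈ u i,
      (T (e k).1 none a + ∑ f : Fin D, ((e k).2 f).elim 0 fun j => T (e k).1 (some (f, j)) a)).det = 0 := by
  classical
  -- the two option families and their affine dependencies
  set L₁ : Finset (Option (Fin N)) := Finset.insertNone (S p f₁) with hL₁
  set L₂ : Finset (Option (Fin N)) := Finset.insertNone (S p f₂) with hL₂
  let x : Option (Fin N) → Fin h → ℂ := fun o a => o.elim 0 fun j => T p (some (f₁, j)) a
  let y : Option (Fin N) → Fin h → ℂ := fun o a => o.elim 0 fun j => T p (some (f₂, j)) a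
  have hc₁ : h + 1 < L₁.card := by rw [hL₁, Finset.card_insertNone]; omega
  have hc₂ : h + 1 < L₂.card := by rw [hL₂, Finset.card_insertNone]; omega
  obtain ⟨Λ, hl0, hl1, o₁, ho₁, hΛ⟩ := affineRelation_of_card h L₁ x hc₁
  obtain ⟨Μ, hm0, hm1, o₂, ho₂, hΜ⟩ := affineRelation_of_card h L₂ y hc₂
  -- the sub-grid: patterns `g o o'` (slot f₁ ↦ o, slot f₂ ↦ o', other slots none)
  let pat : Option (Fin N) → Option (Fin N) → (Fin D → Option (Fin N)) :=
    fun o o' f => if f = f₁ then o else if f = f₂ then o' else none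
  have hpat₁ : ∀ o o', pat o o' f₁ = o := fun o o' => by simp [pat]
  have hpat₂ : ∀ o o', pat o o' f₂ = o' := fun o o' => by simp [pat, hf.symm]
  have hpat₃ : ∀ o o' f, f ≠ f₁ → f ≠ f₂ → pat o o' f = none := fun o o' f h1 h2 => by simp [pat, h1, h2]
  have hlivepat : ∀ o ∈ L₁, ∀ o' ∈ L₂, (p, pat o o') ∈ Set.range e := by
    intro o ho o' ho'
    rw [hlive]
    intro f j hfj
    change pat o o' f = some j at hfj
    change j ∈ S p f
    by_cases h1 : f = f₁
    · rw [h1, hpat₁] at hfj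
      rw [h1]
      exact Finset.mem_insertNone.mp ho j (by rw [hfj]; rfl)
    · by_cases h2 : f = f₂
      · rw [h2, hpat₂] at hfj
        rw [h2]
        exact Finset.mem_insertNone.mp ho' j (by rw [hfj]; rfl)
      · rw [hpat₃ o o' f h1 h2] at hfj; exact absurd hfj (by simp)
  -- membership of a column in the sub-grid
  let InGrid : Fin r → Prop := fun k => (e k).1 = p ∧ ∀ f, f ≠ f₁ → f ≠ f₂ → (e k).2 f = none
  have hgrid₁ : ∀ k, InGrid k → (e k).2 f₁ ∈ L₁ := by
    intro k hk
    rw [hL₁, Finset.mem_insertNone]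
    intro j hj
    have := ((hlive (e k)).mp ⟨k, rfl⟩) f₁ j hj
    rw [hk.1] at this; exact this
  have hgrid₂ : ∀ k, InGrid k → (e k).2 f₂ ∈ L₂ := by
    intro k hk
    rw [hL₂, Finset.mem_insertNone]
    intro j hj
    have := ((hlive (e k)).mp ⟨k, rfl⟩) f₂ j hj
    rw [hk.1] at this; exact this
  have hgridpat : ∀ k, InGrid k → e k = (p, pat ((e k).2 f₁) ((e k).2 f₂)) := by
    intro k hk
    refine Prod.ext hk.1 (funext fun f => ?_)
    change (e k).2 f = pat ((e k).2 f₁) ((e k).2 f₂) f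
    by_cases h1 : f = f₁
    · rw [h1, hpat₁]
    · by_cases h2 : f = f₂
      · rw [h2, hpat₂]
      · rw [hpat₃ _ _ f h1 h2]; exact hk.2 f h1 h2
  -- the kernel vector
  let v : Fin r → ℂ := fun k => if InGrid k then Λ ((e k).2 f₁) * Μ ((e k).2 f₂) else 0
  -- the column of the pattern `(o, o')`
  have hkOf : ∀ oo : Option (Fin N) × Option (Fin N), oo ∈ L₁ ×ˢ L₂ → ∃ k, e k = (p, pat oo.1 oo.2) := by
    intro oo hoo
    obtain ⟨ho, ho'⟩ := Finset.mem_product.mp hoo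
    obtain ⟨k, hk⟩ := hlivepat oo.1 ho oo.2 ho'
    exact ⟨k, hk⟩
  let kOf : Option (Fin N) × Option (Fin N) → Fin r := fun oo =>
    if hoo : oo ∈ L₁ ×ˢ L₂ then (hkOf oo hoo).choose else ⟨0, by
      have : 0 < r := Fin.pos (hkOf (o₁, o₂) (Finset.mem_product.mpr ⟨ho₁, ho₂⟩)).choose
      exact this⟩
  have hkOf_spec : ∀ oo ∈ L₁ ×ˢ L₂, e (kOf oo) = (p, pat oo.1 oo.2) := by
    intro oo hoo
    simp only [kOf, dif_pos hoo]
    exact (hkOf oo hoo).choose_spec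
  have hkOf_grid : ∀ oo ∈ L₁ ×ˢ L₂, InGrid (kOf oo) := by
    intro oo hoo
    refine ⟨by rw [hkOf_spec oo hoo], fun f h1 h2 => ?_⟩
    rw [hkOf_spec oo hoo]
    exact hpat₃ _ _ f h1 h2
  have hv : v ≠ 0 := by
    intro hv
    have hoo : (o₁, o₂) ∈ L₁ ×ˢ L₂ := Finset.mem_product.mpr ⟨ho₁, ho₂⟩
    have h0 := congrFun hv (kOf (o₁, o₂))
    have h1 : v (kOf (o₁, o₂)) = Λ ((e (kOf (o₁, o₂))).2 f₁) * Μ ((e (kOf (o₁, o₂))).2 f₂) := if_pos (hkOf_grid _ hoo)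
    rw [h1, hkOf_spec _ hoo, Pi.zero_apply] at h0
    change Λ (pat o₁ o₂ f₁) * Μ (pat o₁ o₂ f₂) = 0 at h0
    rw [hpat₁, hpat₂] at h0
    exact (mul_eq_zero.mp h0).elim hΛ hΜ
  -- the point of a sub-grid column
  have hpoint : ∀ k, InGrid k → ∀ a, T (e k).1 none a + ∑ f : Fin D, ((e k).2 f).elim 0 (fun j => T (e k).1 (some (f, j)) a) =
      T p none a + x ((e k).2 f₁) a + y ((e k).2 f₂) a := by
    intro k hk a
    rw [hk.1, Fintype.sum_eq_add f₁ f₂ hf]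
    · simp only [x, y, add_assoc]
    · intro f hff
      rw [hk.2 f hff.1 hff.2]; rfl
  -- `M v = 0`
  apply (Matrix.exists_mulVec_eq_zero_iff).mp
  refine ⟨v, hv, funext fun i => ?_⟩
  simp only [Matrix.mulVec, dotProduct, Matrix.of_apply, Pi.zero_apply]
  calc ∑ k, (∏ a ∈ u i, (T (e k).1 none a + ∑ f : Fin D, ((e k).2 f).elim 0 fun j => T (e k).1 (some (f, j)) a)) * v k
      = ∑ k ∈ Finset.univ.filter InGrid, Λ ((e k).2 f₁) * Μ ((e k).2 f₂) *
          ∏ a ∈ u i, (T p none a + x ((e k).2 f₁) a + y ((e k).2 f₂) a) := by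
        rw [Finset.sum_filter]
        refine Finset.sum_congr rfl fun k _ => ?_
        by_cases hk : InGrid k
        · have hv' : v k = Λ ((e k).2 f₁) * Μ ((e k).2 f₂) := if_pos hk
          rw [if_pos hk, hv', Finset.prod_congr rfl fun a _ => hpoint k hk a]
          ring
        · have hv' : v k = 0 := if_neg hk
          rw [if_neg hk, hv', mul_zero]
    _ = ∑ oo ∈ L₁ ×ˢ L₂, Λ oo.1 * Μ oo.2 * ∏ a ∈ u i, (T p none a + x oo.1 a + y oo.2 a) := by
        refine Finset.sum_nbij' (fun k => ((e k).2 f₁, (e k).2 f₂)) kOf ?_ ?_ ?_ ?_ ?_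
        · intro k hk
          have hk' := (Finset.mem_filter.mp hk).2
          exact Finset.mem_product.mpr ⟨hgrid₁ k hk', hgrid₂ k hk'⟩
        · intro oo hoo
          exact Finset.mem_filter.mpr ⟨Finset.mem_univ _, hkOf_grid oo hoo⟩
        · intro k hk
          have hk' := (Finset.mem_filter.mp hk).2
          have hoo : ((e k).2 f₁, (e k).2 f₂) ∈ L₁ ×ˢ L₂ := Finset.mem_product.mpr ⟨hgrid₁ k hk', hgrid₂ k hk'⟩
          apply he
          rw [hkOf_spec _ hoo, ← hgridpat k hk']
        · intro oo hoo
          refine Prod.ext ?_ ?_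
          · show (e (kOf oo)).2 f₁ = oo.1
            rw [hkOf_spec oo hoo]; exact hpat₁ _ _
          · show (e (kOf oo)).2 f₂ = oo.2
            rw [hkOf_spec oo hoo]; exact hpat₂ _ _
        · intro k _; rfl
    _ = ∑ o ∈ L₁, ∑ o' ∈ L₂, Λ o * Μ o' * ∏ a ∈ u i, (T p none a + x o a + y o' a) := Finset.sum_product _ _ _
    _ = 0 := sum_sum_prod_eq_zero L₁ L₂ Λ Μ x y (fun a => T p none a) hl0 hl1 hm0 hm1 (u i) (hu3 i)

end Summit.ValiantsHypothesis.ValiantsHypothesis.Theorems.BarrierLever.SimplexJoin
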